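import Mathlib
import HarnessLib
import Summits.QuantumFields.YangMills.Theorems.MirrorModularBoostsHypercubicLimitClosureHalvesDefs

/-!
# Stub `stub_rpSpectralAnti` (K1) of line `Sketch`, crux `PencilRigidity.WeakCouplingHypercubicLimit`
# (stmt-QuantumFields-16120): `RPSpectral` is antitone in the rate

`RPSpectral r sch Δ C → RPSpectral r sch Δ' (2 * max C 0)` for every `Δ' ≤ Δ` (no sign condition on `Δ'`, `Δ` or
`C`); `stub_rpSpectralAnti` is the registered form with the (unused) extra hypothesis `0 ≤ Δ'`, `rpSpectral_anti` the
c5-registered form without it.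

On each torus of the eventual set and each admissible `(S, T, n, Y, B)` put `X := ⟨ΘY·Y⟩ − ⟨Y⟩²`,
`E := B² e^{−Δ a S}`, `u := e^{−Δ a n}`, `w := e^{(Δ−Δ') a n}`, `W := e^{(Δ−Δ') a S}`, so that `e^{−Δ' a n} = w u`,
`B² e^{−Δ' a S} = W E` and `1 ≤ w ≤ W` (`n ≤ S`, `a_k > 0`).  The `n = 0` instance of the hypothesis reads
`|X| ≤ X + C E`, i.e. `−2X ≤ C E`; the `n`-instance reads `0 ≤ |⟨ΘY·Y_n⟩ − ⟨Y⟩²| ≤ u X + C E`, so `u (−X) ≤ C E`.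
If `X ≥ 0` the claim is monotonicity (`u X ≤ w u X`, `C E ≤ C⁺ W E`); if `X < 0` then `C E > 0` and
`u X + C E ≤ w u X + w u (−X) + C E ≤ w u X + 2 W C E`.  Pure real arithmetic over the definition; no reflection
positivity is used. [folklore]
-/

noncomputable section

open MeasureTheory Filter Topology
open Literature.MathematicalPhysics.AQFT Literature.MathematicalPhysics.QuantumLattice
open Literature.MathematicalPhysics.QuantumFieldTheory
open Summit.QuantumFields.YangMills.Cruxes.HypercubicLimit.CouplingResponse

namespace Summit.QuantumFields.YangMills.Theorems.WeakCouplingHypercubicLimit.TraceNormColdPressure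

/-- The algebraic core of `rpSpectral_anti`: from `|X| ≤ X + C B₂ e` (the `n = 0` instance) and
`0 ≤ L ≤ u X + C B₂ e` (the `n`-instance), with `0 ≤ u`, `1 ≤ w ≤ W`, `0 ≤ B₂`, `0 ≤ e`, one gets
`L ≤ (w u) X + 2 C⁺ B₂ (W e)`. [folklore] -/
private theorem rpSpectralAnti_alg {L X C B₂ e u w W : ℝ} (hL : 0 ≤ L) (hB : 0 ≤ B₂) (he : 0 ≤ e)
    (hu : 0 ≤ u) (hw : 1 ≤ w) (hW : w ≤ W) (h0 : |X| ≤ X + C * B₂ * e)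
    (hn : L ≤ u * X + C * B₂ * e) :
    L ≤ w * u * X + 2 * max C 0 * B₂ * (W * e) := by
  have hC : C ≤ max C 0 := le_max_left _ _
  have hC0 : 0 ≤ max C 0 := le_max_right _ _
  have hE : 0 ≤ B₂ * e := mul_nonneg hB he
  have h2 : C * (B₂ * e) ≤ max C 0 * (B₂ * e) := mul_le_mul_of_nonneg_right hC hE
  have h3 : max C 0 * (B₂ * e) ≤ W * (max C 0 * (B₂ * e)) :=
    le_mul_of_one_le_left (mul_nonneg hC0 hE) (hw.trans hW)
  rcases le_or_gt 0 X with hX | hX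
  · have h1 : 0 ≤ (w - 1) * (u * X) := mul_nonneg (by linarith) (mul_nonneg hu hX)
    have h4 : 0 ≤ W * (max C 0 * (B₂ * e)) :=
      mul_nonneg (by linarith) (mul_nonneg hC0 hE)
    nlinarith [h1, h2, h3, h4]
  · have hX2 : -2 * X ≤ C * (B₂ * e) := by
      have := (abs_le.mp h0).1
      nlinarith [this]
    have hCE : 0 < C * (B₂ * e) := by linarith
    have huX : 0 ≤ u * -X := mul_nonneg hu (by linarith)
    have h5 : w * (u * -X) ≤ w * (C * (B₂ * e)) := by
      refine mul_le_mul_of_nonneg_left ?_ (by linarith)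
      nlinarith [hn, hL]
    have h6 : w * (C * (B₂ * e)) ≤ W * (C * (B₂ * e)) := mul_le_mul_of_nonneg_right hW hCE.le
    have h7 : C * (B₂ * e) ≤ W * (C * (B₂ * e)) := le_mul_of_one_le_left hCE.le (hw.trans hW)
    have h8 : W * (C * (B₂ * e)) ≤ W * (max C 0 * (B₂ * e)) :=
      mul_le_mul_of_nonneg_left h2 (by linarith)
    nlinarith [hn, h5, h6, h7, h8, huX]

/-- The exponential bookkeeping of `rpSpectral_anti`: for `a > 0`, `Δ' ≤ Δ`, `n ≤ S`,
`e^{−Δ' a n} = e^{(Δ−Δ') a n} e^{−Δ a n}`, `e^{−Δ' a S} = e^{(Δ−Δ') a S} e^{−Δ a S}` and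
`1 ≤ e^{(Δ−Δ') a n} ≤ e^{(Δ−Δ') a S}`, whence the algebraic core applies. [folklore] -/
private theorem rpSpectralAnti_exp {L X C B a Δ Δ' : ℝ} {n S : ℕ} (hL : 0 ≤ L) (ha : 0 < a)
    (hle : Δ' ≤ Δ) (hnS : n ≤ S) (h0 : |X| ≤ X + C * B ^ 2 * Real.exp (-(Δ * a * S)))
    (hn : L ≤ Real.exp (-(Δ * a * n)) * X + C * B ^ 2 * Real.exp (-(Δ * a * S))) :
    L ≤ Real.exp (-(Δ' * a * n)) * X + 2 * max C 0 * B ^ 2 * Real.exp (-(Δ' * a * S)) := by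
  have hda : 0 ≤ (Δ - Δ') * a := mul_nonneg (sub_nonneg.mpr hle) ha.le
  have hw : (1 : ℝ) ≤ Real.exp ((Δ - Δ') * a * n) :=
    Real.one_le_exp (mul_nonneg hda (Nat.cast_nonneg n))
  have hW : Real.exp ((Δ - Δ') * a * n) ≤ Real.exp ((Δ - Δ') * a * S) :=
    Real.exp_le_exp.mpr (mul_le_mul_of_nonneg_left (Nat.cast_le.mpr hnS) hda)
  have e1 : Real.exp (-(Δ' * a * n)) = Real.exp ((Δ - Δ') * a * n) * Real.exp (-(Δ * a * n)) := by
    rw [← Real.exp_add]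
    congr 1
    ring
  have e2 : Real.exp (-(Δ' * a * S)) = Real.exp ((Δ - Δ') * a * S) * Real.exp (-(Δ * a * S)) := by
    rw [← Real.exp_add]
    congr 1
    ring
  rw [e1, e2]
  exact rpSpectralAnti_alg hL (sq_nonneg B) (Real.exp_nonneg _) (Real.exp_nonneg _) hw hW h0 hn

/-- The trivial translation of lattice gauge configurations. [folklore] -/
private theorem configShift_zero_eq {d : ℕ} {G : Type} [MeasurableSpace G] (V : LGConfig d G) :
    configShift 0 V = V := by
  funext x
  simp

/-- `rpSpectral_anti` (the c5-registered sub-goal of line `Sketch`) — **`RPSpectral` is antitone in the rate** at the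
cost of doubling the thermal constant: for `Δ' ≤ Δ`, `RPSpectral r sch Δ C → RPSpectral r sch Δ' (2 * max C 0)`.  The
`n = 0` instance of `RPSpectral` bounds the bracket `X = ⟨ΘY·Y⟩ − ⟨Y⟩²` below by `−(C/2) B² e^{−Δ a S}` and the
non-negativity of the left-hand side bounds `e^{−Δ a n} (−X)` by `C B² e^{−Δ a S}`; no reflection positivity and no sign
condition on `Δ'` are needed (see the module docstring). [folklore] -/
theorem rpSpectral_anti :
    ∀ (G : Type) [Group G] [TopologicalSpace G] [IsTopologicalGroup G] [CompactSpace G]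
      [MeasurableSpace G] [BorelSpace G] (r : LatticeRep G) (sch : SpeciesScheme (YMSpecies G)) (Δ Δ' C : ℝ),
      Δ' ≤ Δ → RPSpectral r sch Δ C → RPSpectral r sch Δ' (2 * max C 0) := by
  intro G _ _ _ _ _ _ r sch Δ Δ' C hle hRP
  refine hRP.mono fun k hk => ?_
  intro S T n hLS hS Y B hY hB hdep
  have hn := hk S T n hLS hS Y B hY hB hdep
  have h0 := hk S T 0 hLS (by omega) Y B hY hB hdep
  simp only [Nat.cast_zero, Pi.single_zero, neg_zero, configShift_zero_eq, mul_zero, Real.exp_zero,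
    one_mul] at h0
  exact rpSpectralAnti_exp (abs_nonneg _) (sch.a_pos k) hle (by omega) h0 hn

/-- `stub_rpSpectralAnti` (K1 of line `Sketch`, registered on stmt-QuantumFields-16120) — **`RPSpectral` is antitone
in the rate** at the cost of doubling the thermal constant: for `0 ≤ Δ' ≤ Δ`,
`RPSpectral r sch Δ C → RPSpectral r sch Δ' (2 * max C 0)`.  Immediate from `rpSpectral_anti`, which does not need
`0 ≤ Δ'`. [folklore] -/
theorem stub_rpSpectralAnti :
    ∀ (G : Type) [Group G] [TopologicalSpace G] [IsTopologicalGroup G] [CompactSpace G]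
      [MeasurableSpace G] [BorelSpace G] (r : LatticeRep G) (sch : SpeciesScheme (YMSpecies G)) (Δ Δ' C : ℝ),
      0 ≤ Δ' → Δ' ≤ Δ → RPSpectral r sch Δ C → RPSpectral r sch Δ' (2 * max C 0) :=
  fun G _ _ _ _ _ _ r sch Δ Δ' C _ hle hRP => rpSpectral_anti G r sch Δ Δ' C hle hRP

end Summit.QuantumFields.YangMills.Theorems.WeakCouplingHypercubicLimit.TraceNormColdPressure

end
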